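import Mathlib
import HarnessLib
import Literature.Probability.LatticeModels.LatticeGraph
import Summits.HubbardSuperconductivity.HubbardSuperconductivity.Theorems.BalabanIRBirComplexStableXYReality
import Summits.HubbardSuperconductivity.HubbardSuperconductivity.Theorems.BalabanIRBirComplexStableXYEvenPositivity

/-!
# Route BalabanIR — support item `BirRClassEvenNoZeros` (stmt-HubbardSuperconductivity-14998)

CLASS-ARTEFACT CERTIFICATE for the negative lemma on the rev-0 engine record
(`BirComplexStableXY_false_of_WitnessZeroExists`). In the restated class of crux 2R — Fourier
tables `c` on the window `W₂ = Fin 2 × Fin 2 × Fin 2` with the time-reflection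
(Osterwalder–Schrader) Hermiticity (R) `c (n ∘ R) = conj (c (-n))`, `R (a,b,t) = (a,b,rev t)` —
for EVERY real coupling `K`, every `L ≥ 1` and every EVEN `M ≥ 1`, the engine's partition function
`Z = ∫_{[0,2π]^Λ} exp (-A θ) dθ` (same `sh`, `F`, `A`, `cube` as the engine decls of the route file)
is a strictly positive real number: `0 < Re Z ∧ Im Z = 0`. No smallness, no (U1)/(N)/(A)/(C).

Proof (a corollary of two landed theorems):
* `timeReflection_functional_of_table 2 c hc` (module `…Theorems.BalabanIRBirComplexStableXYReality`)
  turns the table form of (R) into the functional form `F (φ ∘ R) = conj (F φ)`;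
* `birEven_partitionFunction_pos c K L M hR hM` (module
  `…Theorems.BalabanIRBirComplexStableXYEvenPositivity`: Hermitian two-slice transfer kernel,
  `Z_M = ∫ ‖G_{M/2-1}(a,·)‖² da > 0` at even `M`) gives `0 < Z.re ∧ Z.im = 0 ∧ Z ≠ 0`.

Design constraint (route header, MATERIALISATION RULE): this module does NOT import the route module
`Summits.HubbardSuperconductivity.HubbardSuperconductivity.Theses.BalabanIR` (the gate links
`BirRClassEvenNoZeros_holds := _root_.<thm>` by importing THIS module into the route file; an import
of the route file here would close a cycle). The theorem's type is therefore the item's body written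
out VERBATIM, so that it is the route decl
`Summit.HubbardSuperconductivity.HubbardSuperconductivity.Theses.BalabanIR.BirRClassEvenNoZeros`
by `δ`-unfolding alone (same device as `Theorems/BalabanIRAssemblyFrame.lean`).
-/

namespace Summit.HubbardSuperconductivity.HubbardSuperconductivity.Theorems

open scoped BigOperators ComplexConjugate

/-- **`BirRClassEvenNoZeros` (item stmt-HubbardSuperconductivity-14998), structural form.**
For every Fourier table `c` on the window `Fin 2 × Fin 2 × Fin 2` satisfying the time-reflection
Hermiticity (R) `c (n ∘ R) = conj (c (-n))`, every real `K`, every `L, M ≥ 1` with `M` even, the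
partition function `Z = ∫_{[0,2π]^Λ} exp (-A θ) dθ` of the BalabanIR engine (`Λ = (ℤ/L)² × ℤ/M`,
`A θ = K Σ_s F (θ ∘ sh s)`, `F φ = Σ_n c_n e^{i n·φ}`) satisfies `0 < Z.re ∧ Z.im = 0`.
The type is the body of the route decl `…Theses.BalabanIR.BirRClassEvenNoZeros`, verbatim. -/
theorem birRClassEvenNoZeros_proof :
    ∀ (c : ((Fin 2 × Fin 2 × Fin 2) → ℤ) →₀ ℂ), (∀ n : (Fin 2 × Fin 2 × Fin 2) → ℤ, c (fun w => n (w.1, w.2.1, Fin.rev w.2.2)) = (starRingEnd ℂ) (c (-n))) → ∀ (K : ℝ) (L M : ℕ) [NeZero L] [NeZero M], Even M → let sh : (Literature.Probability.LatticeModels.TorusSite 2 L × ZMod M) → (Fin 2 × Fin 2 × Fin 2) → (Literature.Probability.LatticeModels.TorusSite 2 L × ZMod M) := fun s w => (s.1 + ![((w.1 : ℕ) : ZMod L), ((w.2.1 : ℕ) : ZMod L)], s.2 + ((w.2.2 : ℕ) : ZMod M)); let F : ((Fin 2 × Fin 2 × Fin 2) → ℝ) → ℂ := fun (φ : (Fin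 2 × Fin 2 × Fin 2) → ℝ) => c.sum (fun n a => a * Complex.exp (Complex.I * ((∑ w, (n w : ℝ) * φ w : ℝ) : ℂ))); let A : ((Literature.Probability.LatticeModels.TorusSite 2 L × ZMod M) → ℝ) → ℂ := fun θ => (K : ℂ) * ∑ s : (Literature.Probability.LatticeModels.TorusSite 2 L × ZMod M), F (fun w => θ (sh s w)); let cube : Set ((Literature.Probability.LatticeModels.TorusSite 2 L × ZMod M) → ℝ) := Set.pi Set.univ (fun _ => Set.Icc (0:ℝ) (2 * Real.pi)); let Z : ℂ := MeasureTheory.integral (MeasureTheory.volume.restrict cube) (fun θ => Complex.exp (-(A θ))); 0 < Z.re ∧ Z.im = 0 := by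
  intro c hc K L M _ _ hM
  have hR := timeReflection_functional_of_table 2 c hc
  obtain ⟨hre, him, -⟩ := birEven_partitionFunction_pos c K L M hR hM
  exact ⟨hre, him⟩

end Summit.HubbardSuperconductivity.HubbardSuperconductivity.Theorems
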